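import Summits.AtomisticToContinuum.HydrodynamicLimit.Theses.JParityClosure
import Summits.AtomisticToContinuum.HydrodynamicLimit.Theses.InformationPercolationEngine
import Summits.AtomisticToContinuum.HydrodynamicLimit.Theses.TwoClocks
import Summits.AtomisticToContinuum.HydrodynamicLimit.Theses.LimitCollisionMeasure
import Summits.AtomisticToContinuum.HydrodynamicLimit.Theorems.InformationPercolationEngineChaosClosesEulerEnskogIdentity
import Summits.AtomisticToContinuum.HydrodynamicLimit.Theorems.InformationPercolationEngineChaosClosesEulerCollisionMomentUI
import Summits.AtomisticToContinuum.HydrodynamicLimit.Theorems.InformationPercolationEngineChaosClosesEulerReadout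
import Summits.AtomisticToContinuum.HydrodynamicLimit.Theorems.JParityClosureParityBandClosurePressureValueOfEvenStress
import HarnessLib

/-!
# Line `Sketch` — crux `JParityClosure.ParityBandClosure` (stmt-AtomisticToContinuum-17608), lead's skeleton v3.1 (v1 + wave-1 landing + reshape of the kinetic half + landed sub-goal chain)

THE CRUX. `ParityBandClosure := OddContactSymmetry → EvenStressEnskog → RateFloor → LocalSecondLaw → DensityCap →
_root_.HydrodynamicLimit` — the closure step of route JParityClosure (five physics cruxes ⇒ the packing-guarded
conjunct, `χ`-tested convergence in probability at EVERY `t ∈ [0,T)`).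

THE LINE (`Sketch` = IdeatorTwo's three levers, Cruxes/ParityBandClosure/IdeatorTwoSketch.lean + the three cards
`tempered-entropy-squeeze` (A), `athermal-plain-entropy-gronwall` (B), `transfer-weighted-collision-measure` (C)).
The only Lean-backed closure architecture on the board for this conclusion is the sister line of crux
`InformationPercolationEngine.ChaosClosesEuler` (stmt-15141, `Cruxes/ChaosClosesEuler/Lines/Sketch.lean` v8, 49+ landed
helper files): KINETIC HALF ⇒ (weak stress isotropy `WSI` ∧ collisional pressure value `CPV`, in band, time-integrated)
⇒ BF18 relative-energy Grönwall at fixed mollifier scale (deterministic shell + kinetic reduction) ⇒ time-averaged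
`L¹` closeness of the cone-mollified fields (`MCTA`) ⇒ the LANDED weak readout at the instant `t`
(`ChaosClosesEulerReadout.stub_readout`, p119530) ⇒ the conclusion by name.  This skeleton DOCKS the parity route onto
that pipeline and isolates what is specific to JParityClosure:

* the kinetic half (OWN, the route's thesis; v3: `stub_maxwellDefectVanishes` XL− + `stub_isotropyOfMaxwellDefect` XL−, v1's single `stub_parityIsotropy`): `OddContactSymmetry` (γ̄_a = 0) + `RateFloor` (thick flux
  support) + the PROVED supports `ParitySplit` / `ParityRigidity` / `EmpiricalEnskogIdentity` + `DensityCap` (cut-offs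
  inactive) + the cubic tail `TwoClocks.EnergyCurrentTails` (9235) and the quadratic collision-mark UI ⇒ `WSI`
  (weak isotropy of the full cone-mollified central second-moment tensor, in band, pre-shock).  Dirac local laws are
  isotropic, so NO entropy input is consumed here.
* `stub_pressureValueOfEvenStress` (OWN, L, provable now): `EvenStressEnskog` + `WSI` ⇒ `CPV` — EXACT algebra: summing
  ESE over `(k,l)` against `a_{kl}`, the Enskog tensor identity `∫(g·ω)₊² ω⊗ω dω = (2π/15)(|g|²𝟙 + 2g⊗g)` (landed
  p104685) turns `σ³ Y Σ a_{kl} B^{kl}` into `σ³(4π/15) Y ρ_r [tr a · tr P_r + 2 a:P_r]`; `tr P_r = 3ρ_rθ_r`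
  IDENTICALLY, the traceless part is `WSI` with the continuous cut-off `b ↦ b⁺ g(b) Ỹ(b)` (`Ỹ` the analytic
  continuation of `Y = (3/2π) f_ex′` from `HsEosLowDensity_holds`), and `2(p_hs − ρθ) = 2σ³ρ²θ f_ex′(σ³ρ)` by the
  DEFINITION of `hsCompressibility` — so ESE is exactly the configurational input the Grönwall consumes.
* external inputs (VERBATIM open items of the board, not this line's to prove): `stub_energyCurrentTails` (9235),
  `stub_collisionTightness` (13354, quartic moment tightness ⇒ `CollisionMomentUI` by the landed
  `ChaosClosesEulerCollisionMomentUI.stub_collisionMomentUI` p110597), `stub_collisionRate` (13481, the in-band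
  cut-off COUNT identification the readout/reduction use for windowed upper bounds — `RateFloor` is a LOWER bound and
  `EvenStressEnskog` identifies only transfer-weighted counts), `stub_localSecondLawClamped` (13352: BF18 consumes the
  CLAMPED entropy inequality; the route's plain `LocalSecondLaw` 13081 is NOT consumed — sister NOTES §B3, contested by
  card B), `stub_gronwall` (= the sister line's open `stub_kineticReduction ∘ stub_bf18Shell` fed with its landed
  `MassBalanceC1` / `EmpiricalWeakEquation` / `InitialLayer`; closes the moment those two land).

WHAT THIS SAYS ABOUT THE CRUX AS FILED (for the planner; census in the lead's NOTES.md): of the five antecedents,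
`OddContactSymmetry`, `RateFloor`, `EvenStressEnskog`, `DensityCap` are consumed; `LocalSecondLaw` (13081) is idle
(`_hL`), replaced by the clamped 13352; and 9235 + 13354 + 13481 are needed besides — the same input list the sister
lead reached from the InformationPercolationEngine side (its NOTES §D).  Levers A/B/C of the cards are exactly the
(unformalised) proposals to discharge 9235 (A: tempered-entropy squeeze at the instant), 13352 (B: plain entropy at
fixed `r`) and 13354 (C: transfer-weighted compactness) from the five hypotheses; none has a first Lean lemma beyond
IdeatorTwoSketch.lean, so they are recorded as the routes by which the external stubs could later move inside.

`ParityBandClosure_of : ParityBandClosure` is PROVED below from the stubs by pure logic.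

LANDED SUB-GOALS of the two own stubs (registered with `stub-add`, all `--supports` 17608, cycle 1): the complete
measure-level chain of the parity mechanism —
`ParityBandClosureDetailedBalance.stub_mapInverseCollisionOfOddIntegrals` (p139072: all bounded continuous J-odd marks integrate
to `0` against a finite record `ν` ⇒ `ν.map J = ν`, the limit form of OddContactSymmetry) →
`…DetailedBalance.stub_detailedBalanceOfSymmetricRecord` (p138663: `min(1,e^{−F})·κ` J-invariant + `∫F dκ = 0` (free balance) +
`π ≪ κ` (RateFloor) ⇒ `F = 0` π-a.e.) → `ParityBandClosureIsotropy.stub_productionZeroOfDetailedBalance` (p139366: ⇒ ParityRigidity's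
even production of the mollified law vanishes) → `…Isotropy.stub_isotropyOfVanishingProduction` (p137939, ∘ `parityRigidity_proof` ∘
`stub_isotropyOfDiracOrMaxwellian` p137300: production `0` for all small `ϑ` ⇒ isotropic central second moments `θ𝟙`); and
`ParityBandClosureMaxwellDefect.stub_maxwellDefectTight` (p138337: the rejection statistic is tight given 13354).  What the two own
stubs still owe is the Young-measure extraction of (local law, collision record) in probability with `r`-independent tolerances and
the identification of the limit objects' three properties from the finite-`N` hypotheses (XL formalisation, no new mathematics).
-/

noncomputable section

namespace Summit.AtomisticToContinuum.HydrodynamicLimit.Cruxes.ParityBandClosure.Sketch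

open scoped BigOperators Topology Classical MeasureTheory ENNReal InnerProductSpace
open Filter Set MeasureTheory
open Literature.MathematicalPhysics.KineticTheory
open Literature.Analysis.FluidPDE
open Summit.AtomisticToContinuum.HydrodynamicLimit.Theses

/-! ## §1 Typed waypoints (local names; bodies VERBATIM the sister line's `Cruxes/ChaosClosesEuler/Lines/Sketch.lean` v8) -/

/-- **Uniform integrability of the quadratic collision mark** (sister `CollisionMomentUI`, verbatim): the
`K_N`-functional of `(1 + |vᵢ|² + |vⱼ|²)·1{|vᵢ|² + |vⱼ|² > L}` is small in probability for large `L`.  Derived from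
`LimitCollisionMeasure.CollisionTightness` (13354) by the landed `ChaosClosesEulerCollisionMomentUI.stub_collisionMomentUI`. -/
def CollisionMomentUI : Prop :=
  ∀ (a₀ θ₀ : T3 → ℝ) (u₀ : T3 → V3), Continuous a₀ → Continuous θ₀ → Continuous u₀ →
    (∀ x, 0 < a₀ x) → (∀ x, 0 < θ₀ x) → ∃ σ₀ : ℝ, 0 < σ₀ ∧ ∀ σ : ℝ, 0 < σ → σ < σ₀ →
    ∀ Φ : (N : ℕ) → HardSphereFlow (Torus.geometry (Fin 3)) (hsDiameter σ N) (N + 1),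
    ∀ τ : ℝ, 0 < τ → ∀ η δ : ℝ, 0 < η → 0 < δ → ∃ L : ℝ, ∃ N₀ : ℕ, ∀ N : ℕ, N₀ ≤ N →
    let ε := hsDiameter σ N
    let G : Geometry (Fin 3) T3 := Torus.geometry (Fin 3)
    let γ : Config (N + 1) (Fin 3) T3 → ℝ → Config (N + 1) (Fin 3) T3 := fun z s => (Φ N).flow s z
    let Kc : (Config (N + 1) (Fin 3) T3 → ℝ → Fin (N + 1) → Fin (N + 1) → ℝ) → Config (N + 1) (Fin 3) T3 → ℝ := fun F z =>
      ε / (N + 1 : ℝ) * ∑ᶠ (s : ℝ) (_ : s ∈ collisionTimes G ε (γ z) ∩ Set.Icc 0 τ),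
        ∑ i : Fin (N + 1), ∑ j : Fin (N + 1),
          (if i ≠ j ∧ ‖G.sepVec (γ z s i).1 (γ z s j).1‖ = ε then F z s i j else 0)
    localGibbsLaw σ a₀ u₀ θ₀ N (Φ N)
        {z | η < Kc (fun z s i j => if L < ‖(γ z s i).2‖ ^ 2 + ‖(γ z s j).2‖ ^ 2 then
          1 + ‖(γ z s i).2‖ ^ 2 + ‖(γ z s j).2‖ ^ 2 else 0) z} ≤ ENNReal.ofReal δ

/-- **Weak isotropy of the local pressure tensor, in band, pre-shock** (sister `WeakStressIsotropyInBand`, verbatim):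
for every continuous TRACELESS tensor test field `a(s,x)` and continuous cut-off `g` vanishing on `[η₀,∞)`, the
space–time integral of `g(σ³ρ_r)·a : P_r` (`P_r` the full cone-mollified central second-moment tensor) tends to `0` in
probability (`N → ∞` then `r → 0`).  In THIS line it is the output of the parity mechanism (`stub_parityIsotropy`). -/
def WeakStressIsotropyInBand : Prop :=
  ∃ η₀ : ℝ, 0 < η₀ ∧ ∀ (a₀ θ₀ : T3 → ℝ) (u₀ : T3 → V3), Continuous a₀ → Continuous θ₀ → Continuous u₀ →
    (∀ x, 0 < a₀ x) → (∀ x, 0 < θ₀ x) → ∃ σ₀ : ℝ, 0 < σ₀ ∧ ∀ σ : ℝ, 0 < σ → σ < σ₀ →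
    ∀ (T : ℝ) (ρ θ : ℝ → T3 → ℝ) (u : ℝ → T3 → V3), IsHardSphereEulerSolution σ T ρ u θ →
    ∀ Φ : (N : ℕ) → HardSphereFlow (Torus.geometry (Fin 3)) (hsDiameter σ N) (N + 1),
    TendstoHydroFieldsAt (fun N => localGibbsLaw σ a₀ u₀ θ₀ N (Φ N)) Φ ρ u θ 0 →
    ∀ t ∈ Set.Ico 0 T, ∀ a : Fin 3 → Fin 3 → ℝ × T3 → ℝ, (∀ j k, Continuous (a j k)) →
    (∀ p, ∑ j : Fin 3, a j j p = 0) →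
    ∀ g : ℝ → ℝ, Continuous g → (∀ b, η₀ ≤ b → g b = 0) →
    ∀ η δ : ℝ, 0 < η → 0 < δ → ∃ r₀ : ℝ, 0 < r₀ ∧ ∀ r : ℝ, 0 < r → r < r₀ → ∃ N₀ : ℕ, ∀ N : ℕ, N₀ ≤ N →
    let bx : T3 → T3 → ℝ := fun y x => 3 / (Real.pi * r ^ 3) * max (1 - Torus.euclidDist y x / r) 0
    let ρm : Config (N + 1) (Fin 3) T3 → T3 → ℝ := fun w x₀ => ∫ q, bx q.1 x₀ ∂(empiricalMeasure w)
    let mm : Config (N + 1) (Fin 3) T3 → T3 → V3 := fun w x₀ => ∫ q, bx q.1 x₀ • q.2 ∂(empiricalMeasure w)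
    let Pm : Config (N + 1) (Fin 3) T3 → T3 → Fin 3 → Fin 3 → ℝ := fun w x₀ j k =>
      (∫ q, bx q.1 x₀ * (q.2 j * q.2 k) ∂(empiricalMeasure w)) - mm w x₀ j * mm w x₀ k / ρm w x₀
    localGibbsLaw σ a₀ u₀ θ₀ N (Φ N)
      {z | η < |∫ s in Set.Icc 0 t, ∫ x, g (σ ^ 3 * ρm ((Φ N).flow s z) x) *
        ∑ j : Fin 3, ∑ k : Fin 3, a j k (s, x) * Pm ((Φ N).flow s z) x j k|} ≤ ENNReal.ofReal δ

/-- **Collisional pressure value, in band, pre-shock** (sister `CollisionalPressureValueInBand`, verbatim): the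
normalised collision functional of the stress mark `g(σ³ρ_r(xᵢ))·|(vᵢ⁻−vⱼ⁻)·ω|·(ω⊗ω : a(s,xᵢ))` minus
`2∫₀ᵗ∫ g(σ³ρ_r)(p_hs(ρ_r,θ_r) − ρ_rθ_r) tr a` tends to `0` in probability; factor `2` = ordered pairs.  In THIS line
it follows from `EvenStressEnskog` + `WSI` by exact algebra (`stub_pressureValueOfEvenStress`). -/
def CollisionalPressureValueInBand : Prop :=
  ∃ η₀ : ℝ, 0 < η₀ ∧ ∀ (a₀ θ₀ : T3 → ℝ) (u₀ : T3 → V3), Continuous a₀ → Continuous θ₀ → Continuous u₀ →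
    (∀ x, 0 < a₀ x) → (∀ x, 0 < θ₀ x) → ∃ σ₀ : ℝ, 0 < σ₀ ∧ ∀ σ : ℝ, 0 < σ → σ < σ₀ →
    ∀ (T : ℝ) (ρ θ : ℝ → T3 → ℝ) (u : ℝ → T3 → V3), IsHardSphereEulerSolution σ T ρ u θ →
    ∀ Φ : (N : ℕ) → HardSphereFlow (Torus.geometry (Fin 3)) (hsDiameter σ N) (N + 1),
    TendstoHydroFieldsAt (fun N => localGibbsLaw σ a₀ u₀ θ₀ N (Φ N)) Φ ρ u θ 0 →
    ∀ t ∈ Set.Ico 0 T, ∀ a : Fin 3 → Fin 3 → ℝ × T3 → ℝ, (∀ j k, Continuous (a j k)) →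
    (∀ j k p, a j k p = a k j p) →
    ∀ g : ℝ → ℝ, Continuous g → (∀ b, η₀ ≤ b → g b = 0) →
    ∀ η δ : ℝ, 0 < η → 0 < δ → ∃ r₀ : ℝ, 0 < r₀ ∧ ∀ r : ℝ, 0 < r → r < r₀ → ∃ N₀ : ℕ, ∀ N : ℕ, N₀ ≤ N →
    let ε := hsDiameter σ N
    let G : Geometry (Fin 3) T3 := Torus.geometry (Fin 3)
    let γ : Config (N + 1) (Fin 3) T3 → ℝ → Config (N + 1) (Fin 3) T3 := fun z s => (Φ N).flow s z
    let bx : T3 → T3 → ℝ := fun y x => 3 / (Real.pi * r ^ 3) * max (1 - Torus.euclidDist y x / r) 0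
    let ρm : Config (N + 1) (Fin 3) T3 → T3 → ℝ := fun w x₀ => ∫ q, bx q.1 x₀ ∂(empiricalMeasure w)
    let mm : Config (N + 1) (Fin 3) T3 → T3 → V3 := fun w x₀ => ∫ q, bx q.1 x₀ • q.2 ∂(empiricalMeasure w)
    let em : Config (N + 1) (Fin 3) T3 → T3 → ℝ := fun w x₀ =>
      ∫ q, bx q.1 x₀ * (‖q.2‖ ^ 2 / 2) ∂(empiricalMeasure w)
    let θm : Config (N + 1) (Fin 3) T3 → T3 → ℝ := fun w x₀ =>
      2 / 3 * (em w x₀ / ρm w x₀ - ‖mm w x₀‖ ^ 2 / (2 * ρm w x₀ ^ 2))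
    let pv : Config (N + 1) (Fin 3) T3 → ℝ → Fin (N + 1) → Fin (N + 1) → V3 × V3 := fun z s i j =>
      reflectVel (G.sepVec (γ z s i).1 (γ z s j).1) ((γ z s i).2, (γ z s j).2)
    let Kc : (Config (N + 1) (Fin 3) T3 → ℝ → Fin (N + 1) → Fin (N + 1) → ℝ) → Config (N + 1) (Fin 3) T3 → ℝ := fun F z =>
      ε / (N + 1 : ℝ) * ∑ᶠ (s : ℝ) (_ : s ∈ collisionTimes G ε (γ z) ∩ Set.Icc 0 t),
        ∑ i : Fin (N + 1), ∑ j : Fin (N + 1),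
          (if i ≠ j ∧ ‖G.sepVec (γ z s i).1 (γ z s j).1‖ = ε then F z s i j else 0)
    let D : Config (N + 1) (Fin 3) T3 → ℝ := fun z =>
      Kc (fun z s i j =>
          g (σ ^ 3 * ρm (γ z s) (γ z s i).1) *
            |⟪(pv z s i j).1 - (pv z s i j).2, ε⁻¹ • G.sepVec (γ z s i).1 (γ z s j).1⟫_ℝ| *
            ∑ k : Fin 3, ∑ l : Fin 3, a k l (s, (γ z s i).1) *
              ((ε⁻¹ • G.sepVec (γ z s i).1 (γ z s j).1) k * (ε⁻¹ • G.sepVec (γ z s i).1 (γ z s j).1) l)) z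
        - 2 * ∫ s in Set.Icc 0 t, ∫ x, g (σ ^ 3 * ρm (γ z s) x) *
            (hsPressure σ (ρm (γ z s) x) (θm (γ z s) x) - ρm (γ z s) x * θm (γ z s) x) *
            ∑ k : Fin 3, a k k (s, x)
    localGibbsLaw σ a₀ u₀ θ₀ N (Φ N) {z | η < |D z|} ≤ ENNReal.ofReal δ

/-- **Mollified fields close in TIME AVERAGE** (sister `MollifiedCloseTimeAveraged`, verbatim): the Grönwall's honest
output and the first hypothesis of the landed weak readout `ChaosClosesEulerReadout.stub_readout`. -/
def MollifiedCloseTimeAveraged : Prop :=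
  ∃ η₀ : ℝ, 0 < η₀ ∧ ∀ (a₀ θ₀ : T3 → ℝ) (u₀ : T3 → V3), Continuous a₀ → Continuous θ₀ → Continuous u₀ →
    (∀ x, 0 < a₀ x) → (∀ x, 0 < θ₀ x) → ∃ σ₀ : ℝ, 0 < σ₀ ∧ ∀ σ : ℝ, 0 < σ → σ < σ₀ →
    ∀ (T : ℝ) (ρ θ : ℝ → T3 → ℝ) (u : ℝ → T3 → V3), IsHardSphereEulerSolution σ T ρ u θ →
    (∀ t ∈ Set.Ico 0 T, ∀ x, ρ t x * σ ^ 3 < η₀) →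
    ∀ Φ : (N : ℕ) → HardSphereFlow (Torus.geometry (Fin 3)) (hsDiameter σ N) (N + 1),
    TendstoHydroFieldsAt (fun N => localGibbsLaw σ a₀ u₀ θ₀ N (Φ N)) Φ ρ u θ 0 →
    ∀ t ∈ Set.Ico 0 T, ∀ Δ : ℝ, 0 < Δ → t + Δ < T → ∀ η δ : ℝ, 0 < η → 0 < δ →
    ∃ r₀ : ℝ, 0 < r₀ ∧ ∀ r : ℝ, 0 < r → r < r₀ → ∃ N₀ : ℕ, ∀ N : ℕ, N₀ ≤ N →
    let bx : T3 → T3 → ℝ := fun y x => 3 / (Real.pi * r ^ 3) * max (1 - Torus.euclidDist y x / r) 0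
    localGibbsLaw σ a₀ u₀ θ₀ N (Φ N)
        {z | η * Δ < ∫ s in Set.Icc t (t + Δ),
          ((∫ x, |empiricalDensityField ((Φ N).flow s z) (fun y => bx y x) - ρ s x|)
          + (∫ x, ‖empiricalMomentumField ((Φ N).flow s z) (fun y => bx y x) - ρ s x • u s x‖)
          + ∫ x, |empiricalEnergyField ((Φ N).flow s z) (fun y => bx y x) -
              totalEnergyDensity (ρ s x) (u s x) (θ s x)|)} ≤ ENNReal.ofReal δ

/-- **Metropolis rejection mass of the pre-shock collision record vanishes, in band** (v3; the typed
LocalVelocityEquilibration node of the route = the card's `M₃` "collisional Maxwell defect"): OddContactSymmetry's frame and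
`let`-chain VERBATIM (tied classical hs-Euler solution on `[0,T)`, horizon `0 < τ < T`, continuous weight `χ`, continuous density
cut-off `g` vanishing on `[η₀,∞)`, `(r,ϑ)`-mollified empirical law `hm`, surprisal jump `F`, normalised collision functional `Kc`),
with the Metropolis-weighted odd mark replaced by the REJECTION mark `1 − min 1 (exp (−F)) ∈ [0,1]` (bounded; `≈ |F| ≈ |Δv|·|∇log h|`
at grazing incidence, so grazing storms are inert): `K_N[χ g (1 − min(1,e^{−F}))] → 0` in probability (`N → ∞` at fixed
`r, ϑ < r₀(η,δ)`). Limit content: `∫ γ̄ (h̄h̄_* − h̄′h̄′_*)₊ B = 0`, i.e. `h̄h̄_* = h̄′h̄′_*` on the support of the limit contact law.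
Mechanism (stub_maxwellDefectVanishes): free collisional balance (`empiricalEnskogIdentity_proof` ÷ count, surprisal marks
admissible by truncation + 9235 + 13354) gives `∫ γ̄ h̄h̄_* F̄ B = 0`; `paritySplit_proof` splits it into
`½∫γ̄_s(h̄h̄_*−h̄′h̄′_*)F̄B + ½∫γ̄_a(h̄h̄_*+h̄′h̄′_*)F̄B`; OddContactSymmetry kills the odd term on `{h̄ > 0}`; the even integrand is
`≥ 0` pointwise, so `γ̄_s(h̄h̄_*−h̄′h̄′_*) = 0` a.e., and `supp κ̄ ⊆ {γ̄ > 0} ⊆ {γ̄_s > 0}`. MD-checkable (EDMD driver of kit j013997: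
rejection mass of recorded collisions, equilibrium null, pre-shock shear/two-temperature data). -/
def MaxwellDefectVanishesInBand : Prop :=
  ∃ η₀ : ℝ, 0 < η₀ ∧ ∀ (a₀ θ₀ : Literature.MathematicalPhysics.KineticTheory.T3 → ℝ) (u₀ : Literature.MathematicalPhysics.KineticTheory.T3 → Literature.MathematicalPhysics.KineticTheory.V3), Continuous a₀ → Continuous θ₀ → Continuous u₀ → (∀ x, 0 < a₀ x) → (∀ x, 0 < θ₀ x) → ∃ σ₀ : ℝ, 0 < σ₀ ∧ ∀ σ : ℝ, 0 < σ → σ < σ₀ → ∀ (T : ℝ) (ρ θ : ℝ → Literature.MathematicalPhysics.KineticTheory.T3 → ℝ) (u : ℝ → Literature.MathematicalPhysics.KineticTheory.T3 → Literature.MathematicalPhysics.KineticTheory.V3), Literature.MathematicalPhysics.KineticTheory.IsHardSphereEulerSolution σ T ρ u θ → ∀ Φ : (N : ℕ) → Literature.Analysis.FluidPDE.HardSphereFlow (Literature.Analysis.FluidPDE.Torus.geometry (Fin 3)) (Literature.MathematicalPhysics.KineticTheory.hsDiameter σ N) (N + 1), Literature.MathematicalPhysics.KineticTheory.TendstoHydroFieldsAt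 (fun N => Literature.MathematicalPhysics.KineticTheory.localGibbsLaw σ a₀ u₀ θ₀ N (Φ N)) Φ ρ u θ 0 → ∀ τ : ℝ, 0 < τ → τ < T → ∀ χ : ℝ × UnitAddTorus (Fin 3) → ℝ, Continuous χ → ∀ g : ℝ → ℝ, Continuous g → (∀ a, η₀ ≤ a → g a = 0) → ∀ η δ : ℝ, 0 < η → 0 < δ → ∃ r₀ : ℝ, 0 < r₀ ∧ ∀ r ϑ : ℝ, 0 < r → r < r₀ → 0 < ϑ → ϑ < r₀ → ∃ N₀ : ℕ, ∀ N : ℕ, N₀ ≤ N → let ε := Literature.MathematicalPhysics.KineticTheory.hsDiameter σ N; let G := Literature.Analysis.FluidPDE.Torus.geometry (Fin 3); let γ := fun z (s : ℝ) => (Φ N).flow s z; let bx : UnitAddTorus (Fin 3) → UnitAddTorus (Fin 3) → ℝ := fun x y => 3 / (Real.pi * r ^ 3) * max (1 - Literature.Analysis.FluidPDE.Torus.euclidDist x y / r) 0; let ρm := fun z s (x₀ : UnitAddTorus (Fin 3)) => ∫ q, bx q.1 x₀ ∂(Literature.Analysis.FluidPDE.empiricalMeasure (γ z s)); let hm :=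 fun z s (x₀ : UnitAddTorus (Fin 3)) (v : EuclideanSpace ℝ (Fin 3)) => ∫ q, bx q.1 x₀ * Literature.Analysis.FluidPDE.localMaxwellian 1 (ϑ ^ 2) v q.2 ∂(Literature.Analysis.FluidPDE.empiricalMeasure (γ z s)); let pv := fun z s (i j : Fin (N + 1)) => Literature.Analysis.FluidPDE.reflectVel (G.sepVec (γ z s i).1 (γ z s j).1) ((γ z s i).2, (γ z s j).2); let F := fun z s (i j : Fin (N + 1)) => Real.log (hm z s (γ z s i).1 (pv z s i j).1) + Real.log (hm z s (γ z s i).1 (pv z s i j).2) - Real.log (hm z s (γ z s i).1 (γ z s i).2) - Real.log (hm z s (γ z s i).1 (γ z s j).2); let Kc := fun (Fn : Literature.Analysis.FluidPDE.Config (N + 1) (Fin 3) Literature.MathematicalPhysics.KineticTheory.T3 → ℝ → Fin (N + 1) → Fin (N + 1) → ℝ) z => ε / (N + 1 : ℝ) * ∑ᶠ (s : ℝ) (_ : s ∈ Literature.Analysis.FluidPDE.collisionTimes G ε (γ z) ∩ Set.Icc 0 τ), ∑ i : Fin (N + 1), ∑ j : Fin (N + 1), (if i ≠ j ∧ ‖G.sepVec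 (γ z s i).1 (γ z s j).1‖ = ε then Fn z s i j else 0); let D := fun z => Kc (fun z s i j => χ (s, (γ z s i).1) * g (σ ^ 3 * ρm z s (γ z s i).1) * (1 - min 1 (Real.exp (-F z s i j)))) z; Literature.MathematicalPhysics.KineticTheory.localGibbsLaw σ a₀ u₀ θ₀ N (Φ N) {z | η < |D z|} ≤ ENNReal.ofReal δ

/-! ## §2 The stubs -/

/-- STUB (external, VERBATIM the shared crux stmt-AtomisticToContinuum-9235 `TwoClocks.EnergyCurrentTails`): the cubic
one-body tail, consumed by the kinetic half (unbounded second moments in `WSI`) and by the readout (windowed cubic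
current at the instant `t`).  Card A (`tempered-entropy-squeeze`) is the proposal to do without it; not formalised. -/
theorem stub_energyCurrentTails : TwoClocks.EnergyCurrentTails := by
  sorry

/-- STUB (external, VERBATIM the support stmt-AtomisticToContinuum-13354 `LimitCollisionMeasure.CollisionTightness`):
quartic moment tightness of the normalised collision measure; gives `CollisionMomentUI` by the landed p110597.  The
route's own `JParityClosure.CollisionTightness` (13085, the bare count) is too weak for this; card C
(`transfer-weighted-collision-measure`) is the proposal to replace it by the trace of `EvenStressEnskog`; not formalised. -/
theorem stub_collisionTightness : LimitCollisionMeasure.CollisionTightness := by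
  sorry

/-- STUB (external, VERBATIM the crux stmt-AtomisticToContinuum-13481 `InformationPercolationEngine.CollisionRate`):
in-band identification of the cut-off collision COUNT, used by the reduction and the readout for windowed UPPER bounds
(`K[bump·g] ≤ C·Δ + η`).  `RateFloor` (13080) is the matching LOWER bound and `EvenStressEnskog` identifies only the
transfer-weighted count, so neither substitutes for it inside the landed readout. -/
theorem stub_collisionRate : InformationPercolationEngine.CollisionRate := by
  sorry

/-- STUB (external, VERBATIM the shared crux stmt-AtomisticToContinuum-13352 `LimitCollisionMeasure.LocalSecondLaw`):
the CLAMPED, cut-EOS local entropy inequality — the format BF18's Grönwall consumes (sister NOTES §B3).  The route's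
plain `JParityClosure.LocalSecondLaw` (13081) is not consumed by this line; card B (`athermal-plain-entropy-gronwall`)
is the (contested) proposal that the plain one suffices at fixed `r`. -/
theorem stub_localSecondLawClamped : LimitCollisionMeasure.LocalSecondLaw := by
  sorry

/-- STUB (external: the sister line's `stub_kineticReduction ∘ stub_bf18Shell`, crux 15141, both "one assembly away"
per its PICKED.md c3, fed with its LANDED `MassBalanceC1`, `EmpiricalWeakEquation` p108039, `InitialLayer` p97752):
THE RELATIVE-ENERGY GRÖNWALL — flux closures `WSI`, `CPV` + quadratic collision-mark UI + in-band count + clamped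
entropy inequality + fine-scale cap ⇒ time-averaged `L¹` closeness of the cone-mollified fields. -/
theorem stub_gronwall :
    WeakStressIsotropyInBand → CollisionalPressureValueInBand → CollisionMomentUI →
    InformationPercolationEngine.CollisionRate → LimitCollisionMeasure.LocalSecondLaw →
    InformationPercolationEngine.DensityCap → MollifiedCloseTimeAveraged := by
  sorry

/-- STUB (OWN, XL−, v3 reshape of `stub_parityIsotropy`, part 1 — the PARITY MECHANISM PROPER; held by the lead; promote-stub
candidate: it is the route's typed LocalVelocityEquilibration node): `OddContactSymmetry` (17722) with the cut-offs kept inactive by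
`DensityCap`, the cubic one-body tail (9235) and the quartic collision tightness (13354, admissibility of the surprisal marks and
tightness of the cut-off count) imply that the Metropolis REJECTION MASS of the pre-shock collision record vanishes:
`MaxwellDefectVanishesInBand`. `RateFloor` is NOT needed here (it enters part 2). -/
theorem stub_maxwellDefectVanishes :
    JParityClosure.OddContactSymmetry → JParityClosure.DensityCap → TwoClocks.EnergyCurrentTails →
    LimitCollisionMeasure.CollisionTightness → MaxwellDefectVanishesInBand := by
  sorry

/-- STUB (OWN, XL−, v3 reshape of `stub_parityIsotropy`, part 2 — RIGIDITY TO ISOTROPY): vanishing rejection mass + `RateFloor`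
(13080: the limit contact law dominates `g₀ ×` the ideal one, so its support contains the whole flux support of `h̄h̄_* B` — NO rate
ceiling / absolute continuity is needed) ⇒ for every small `ϑ` the ideal even production of `μ̄_{s,x} ⋆ G_ϑ` vanishes a.e. in band ⇒
`parityRigidity_proof` ⇒ every subsequential local velocity law is a point mass or a Maxwellian — BOTH have isotropic central second
moments; the cubic tail (9235) and 13354 pay the unbounded moments and the joint Young-measure extraction of (local law, collision
measure); `DensityCap` keeps `g` inactive. Output `WeakStressIsotropyInBand` verbatim. In the Young-measure world there is no
`ϑ`-quantifier clash (exact zeros for all small `ϑ` simultaneously); a Young-measure-free quantitative modulus clashes with OCS's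
`∀η δ ∃r₀ ∀ r,ϑ < r₀` format (lead NOTES, cycle-2 reshape analysis). -/
theorem stub_isotropyOfMaxwellDefect :
    MaxwellDefectVanishesInBand → JParityClosure.RateFloor → JParityClosure.DensityCap → TwoClocks.EnergyCurrentTails →
    LimitCollisionMeasure.CollisionTightness → WeakStressIsotropyInBand := by
  sorry

/-- CLOSED (landed p136561, wave 1, `Theorems.ParityBandClosurePressureValue.stub_pressureValueOfEvenStress`, helpers p135710
p135893 p136158; the symmetry hypothesis on `a` is not used): `EvenStressEnskog` + weak stress isotropy ⇒ the collisional pressure value.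
Sum `EvenStressEnskog` (13079) over `(k,l)` with `χ := a_{kl}`; on the good set the recorded mark
`max ⟪vⱼ⁻ − vᵢ⁻, n̂⟫ 0 · n̂ₖn̂ₗ` equals `|⟪vᵢ⁻ − vⱼ⁻, n̂⟫|·n̂ₖn̂ₗ` (incoming pairs, `binary`); the Enskog tensor identity
(landed p104685) gives `Σ a_{kl} Θ^{kl}(v,w) = (2π/15)(|v−w|² tr a + 2(v−w)·a(v−w))`, hence
`Σ a_{kl} B^{kl} = (4π/15) ρ_r (tr a · tr P_r + 2 a:P_r)` with `tr P_r = 3ρ_rθ_r` identically; the traceless part of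
`a` is paid by `WSI` with the continuous cut-off `b ↦ b⁺·g(b)·Ỹ(b)` (`Ỹ` = `(3/2π)F′`, `F` the analytic band function
of `HsEosLowDensity_holds`, equal to `Y` on `(0, η₀]`), and the trace part is EXACTLY `2(p_hs(ρ_r,θ_r) − ρ_rθ_r) tr a`
since `hsCompressibility η = 1 + η·deriv hsExcessFreeEnergy η` by definition.  `η₀ := min(η₀ᴱˢᴱ, η₀ᵂˢᴵ, η₀ᴱ/2)`.
Signature: `EvenStressEnskog → WeakStressIsotropyInBand → CollisionalPressureValueInBand`, bodies expanded. -/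
theorem stub_pressureValueOfEvenStress :
    JParityClosure.EvenStressEnskog →
    (∃ η₀ : ℝ, 0 < η₀ ∧ ∀ (a₀ θ₀ : T3 → ℝ) (u₀ : T3 → V3), Continuous a₀ → Continuous θ₀ → Continuous u₀ →
    (∀ x, 0 < a₀ x) → (∀ x, 0 < θ₀ x) → ∃ σ₀ : ℝ, 0 < σ₀ ∧ ∀ σ : ℝ, 0 < σ → σ < σ₀ →
    ∀ (T : ℝ) (ρ θ : ℝ → T3 → ℝ) (u : ℝ → T3 → V3), IsHardSphereEulerSolution σ T ρ u θ →
    ∀ Φ : (N : ℕ) → HardSphereFlow (Torus.geometry (Fin 3)) (hsDiameter σ N) (N + 1),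
    TendstoHydroFieldsAt (fun N => localGibbsLaw σ a₀ u₀ θ₀ N (Φ N)) Φ ρ u θ 0 →
    ∀ t ∈ Set.Ico 0 T, ∀ a : Fin 3 → Fin 3 → ℝ × T3 → ℝ, (∀ j k, Continuous (a j k)) →
    (∀ p, ∑ j : Fin 3, a j j p = 0) →
    ∀ g : ℝ → ℝ, Continuous g → (∀ b, η₀ ≤ b → g b = 0) →
    ∀ η δ : ℝ, 0 < η → 0 < δ → ∃ r₀ : ℝ, 0 < r₀ ∧ ∀ r : ℝ, 0 < r → r < r₀ → ∃ N₀ : ℕ, ∀ N : ℕ, N₀ ≤ N →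
    let bx : T3 → T3 → ℝ := fun y x => 3 / (Real.pi * r ^ 3) * max (1 - Torus.euclidDist y x / r) 0
    let ρm : Config (N + 1) (Fin 3) T3 → T3 → ℝ := fun w x₀ => ∫ q, bx q.1 x₀ ∂(empiricalMeasure w)
    let mm : Config (N + 1) (Fin 3) T3 → T3 → V3 := fun w x₀ => ∫ q, bx q.1 x₀ • q.2 ∂(empiricalMeasure w)
    let Pm : Config (N + 1) (Fin 3) T3 → T3 → Fin 3 → Fin 3 → ℝ := fun w x₀ j k =>
      (∫ q, bx q.1 x₀ * (q.2 j * q.2 k) ∂(empiricalMeasure w)) - mm w x₀ j * mm w x₀ k / ρm w x₀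
    localGibbsLaw σ a₀ u₀ θ₀ N (Φ N)
      {z | η < |∫ s in Set.Icc 0 t, ∫ x, g (σ ^ 3 * ρm ((Φ N).flow s z) x) *
        ∑ j : Fin 3, ∑ k : Fin 3, a j k (s, x) * Pm ((Φ N).flow s z) x j k|} ≤ ENNReal.ofReal δ) →
    (∃ η₀ : ℝ, 0 < η₀ ∧ ∀ (a₀ θ₀ : T3 → ℝ) (u₀ : T3 → V3), Continuous a₀ → Continuous θ₀ → Continuous u₀ →
    (∀ x, 0 < a₀ x) → (∀ x, 0 < θ₀ x) → ∃ σ₀ : ℝ, 0 < σ₀ ∧ ∀ σ : ℝ, 0 < σ → σ < σ₀ →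
    ∀ (T : ℝ) (ρ θ : ℝ → T3 → ℝ) (u : ℝ → T3 → V3), IsHardSphereEulerSolution σ T ρ u θ →
    ∀ Φ : (N : ℕ) → HardSphereFlow (Torus.geometry (Fin 3)) (hsDiameter σ N) (N + 1),
    TendstoHydroFieldsAt (fun N => localGibbsLaw σ a₀ u₀ θ₀ N (Φ N)) Φ ρ u θ 0 →
    ∀ t ∈ Set.Ico 0 T, ∀ a : Fin 3 → Fin 3 → ℝ × T3 → ℝ, (∀ j k, Continuous (a j k)) →
    (∀ j k p, a j k p = a k j p) →
    ∀ g : ℝ → ℝ, Continuous g → (∀ b, η₀ ≤ b → g b = 0) →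
    ∀ η δ : ℝ, 0 < η → 0 < δ → ∃ r₀ : ℝ, 0 < r₀ ∧ ∀ r : ℝ, 0 < r → r < r₀ → ∃ N₀ : ℕ, ∀ N : ℕ, N₀ ≤ N →
    let ε := hsDiameter σ N
    let G : Geometry (Fin 3) T3 := Torus.geometry (Fin 3)
    let γ : Config (N + 1) (Fin 3) T3 → ℝ → Config (N + 1) (Fin 3) T3 := fun z s => (Φ N).flow s z
    let bx : T3 → T3 → ℝ := fun y x => 3 / (Real.pi * r ^ 3) * max (1 - Torus.euclidDist y x / r) 0
    let ρm : Config (N + 1) (Fin 3) T3 → T3 → ℝ := fun w x₀ => ∫ q, bx q.1 x₀ ∂(empiricalMeasure w)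
    let mm : Config (N + 1) (Fin 3) T3 → T3 → V3 := fun w x₀ => ∫ q, bx q.1 x₀ • q.2 ∂(empiricalMeasure w)
    let em : Config (N + 1) (Fin 3) T3 → T3 → ℝ := fun w x₀ =>
      ∫ q, bx q.1 x₀ * (‖q.2‖ ^ 2 / 2) ∂(empiricalMeasure w)
    let θm : Config (N + 1) (Fin 3) T3 → T3 → ℝ := fun w x₀ =>
      2 / 3 * (em w x₀ / ρm w x₀ - ‖mm w x₀‖ ^ 2 / (2 * ρm w x₀ ^ 2))
    let pv : Config (N + 1) (Fin 3) T3 → ℝ → Fin (N + 1) → Fin (N + 1) → V3 × V3 := fun z s i j =>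
      reflectVel (G.sepVec (γ z s i).1 (γ z s j).1) ((γ z s i).2, (γ z s j).2)
    let Kc : (Config (N + 1) (Fin 3) T3 → ℝ → Fin (N + 1) → Fin (N + 1) → ℝ) → Config (N + 1) (Fin 3) T3 → ℝ := fun F z =>
      ε / (N + 1 : ℝ) * ∑ᶠ (s : ℝ) (_ : s ∈ collisionTimes G ε (γ z) ∩ Set.Icc 0 t),
        ∑ i : Fin (N + 1), ∑ j : Fin (N + 1),
          (if i ≠ j ∧ ‖G.sepVec (γ z s i).1 (γ z s j).1‖ = ε then F z s i j else 0)
    let D : Config (N + 1) (Fin 3) T3 → ℝ := fun z =>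
      Kc (fun z s i j =>
          g (σ ^ 3 * ρm (γ z s) (γ z s i).1) *
            |⟪(pv z s i j).1 - (pv z s i j).2, ε⁻¹ • G.sepVec (γ z s i).1 (γ z s j).1⟫_ℝ| *
            ∑ k : Fin 3, ∑ l : Fin 3, a k l (s, (γ z s i).1) *
              ((ε⁻¹ • G.sepVec (γ z s i).1 (γ z s j).1) k * (ε⁻¹ • G.sepVec (γ z s i).1 (γ z s j).1) l)) z
        - 2 * ∫ s in Set.Icc 0 t, ∫ x, g (σ ^ 3 * ρm (γ z s) x) *
            (hsPressure σ (ρm (γ z s) x) (θm (γ z s) x) - ρm (γ z s) x * θm (γ z s) x) *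
            ∑ k : Fin 3, a k k (s, x)
    localGibbsLaw σ a₀ u₀ θ₀ N (Φ N) {z | η < |D z|} ≤ ENNReal.ofReal δ) :=
  Summit.AtomisticToContinuum.HydrodynamicLimit.Theorems.ParityBandClosurePressureValue.stub_pressureValueOfEvenStress

/-! ## §3 The composition (pure logic, no `sorry`) -/

/-- **The line closes the crux modulo its stubs (v1).**  Consumed: `OddContactSymmetry`, `RateFloor`, `DensityCap`
(kinetic half and, re-addressed as the syntactically identical `InformationPercolationEngine.DensityCap`, Grönwall and
readout), `EvenStressEnskog` (pressure value).  NOT consumed: `LocalSecondLaw` (13081, plain) — the Grönwall takes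
the clamped 13352.  Readout = the LANDED `ChaosClosesEulerReadout.stub_readout` (p119530); the exact identity
13356 it lists is the LANDED `ChaosClosesEulerEnskogIdentity.stub_empiricalEnskogIdentity` (p107599). -/
theorem ParityBandClosure_of : JParityClosure.ParityBandClosure := fun hO hE hR _hL hD =>
  -- `_hL : JParityClosure.LocalSecondLaw` (13081, plain) is NOT consumed (format, sister NOTES §B3).
  have hD' : InformationPercolationEngine.DensityCap := hD
  have hUI : CollisionMomentUI :=
    Summit.AtomisticToContinuum.HydrodynamicLimit.Theorems.ChaosClosesEulerCollisionMomentUI.stub_collisionMomentUI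
      stub_collisionTightness
  have hW : WeakStressIsotropyInBand :=
    stub_isotropyOfMaxwellDefect (stub_maxwellDefectVanishes hO hD stub_energyCurrentTails stub_collisionTightness)
      hR hD stub_energyCurrentTails stub_collisionTightness
  have hP : CollisionalPressureValueInBand := stub_pressureValueOfEvenStress hE hW
  have hM : MollifiedCloseTimeAveraged :=
    stub_gronwall hW hP hUI stub_collisionRate stub_localSecondLawClamped hD'
  Summit.AtomisticToContinuum.HydrodynamicLimit.Theorems.ChaosClosesEulerReadout.stub_readout hM
    Summit.AtomisticToContinuum.HydrodynamicLimit.Theorems.ChaosClosesEulerEnskogIdentity.stub_empiricalEnskogIdentity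
    stub_energyCurrentTails hUI stub_collisionRate hD'

end Summit.AtomisticToContinuum.HydrodynamicLimit.Cruxes.ParityBandClosure.Sketch

end
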